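import Literature.AlgebraicGeometry.HodgeTheory.BlochSemiregularSpreadOfSubschemeComponents
import Literature.AlgebraicGeometry.HodgeTheory.BlochSemiregularSpreadSmoothComponents
import HarnessLib

/-!
# `BlochSemiregularSpreadSmoothComponents n p` follows from `BlochSemiregularSpreadOfSubscheme n p`
# (Bloch 1972, Thm. (7.4); Buchweitz–Flenner 2003, Thm. 5.2) granted Fulton's degree formula — proved

Family `hodge`, layer `Literature/AlgebraicGeometry/HodgeTheory`. THEOREMS ONLY (no definition, no new
named fact; D-0026). The tree carries two renderings of Bloch's class-level semiregularity theorem for a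
REDUCIBLE local complete intersection, vendored independently for the cell `pub-hsemireg` on 2026-08-22:

* `BlochSemiregularSpreadSmoothComponents n p` (`BlochSemiregularSpreadSmoothComponents.lean`): `Z`
  REDUCED, its support the union of the pairwise distinct images of closed immersions `ιⱼ : Kⱼ ↪ X₀`
  (`j : Fin r`) of smooth projective `m`-folds, class hypothesis `e^*(W|_{𝒳_{s₀}}) = Σⱼ ιⱼ_* 1`
  (`smoothSubvarietyClass`, complex orientations);
* `BlochSemiregularSpreadOfSubscheme n p` (`BlochSemiregularSpreadOfSubscheme.lean`): `Z` an ARBITRARY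
  local complete intersection closed subscheme, class hypothesis `x = [Z]` = `subschemeClass hX₀ hdp ρ i hi`
  (Fulton's cycle `Σᵢ mᵢ[Zᵢ]` of the subscheme under the tree's cycle class through a resolution family
  `ρ`, complex orientations).

This file PROVES that the first is a COROLLARY of the second, granted the tree's named fact
`Fulton1998_degreeFormula_complexOrientation` (Fulton, *Intersection Theory*, Lemma 19.1.2, for the
complex orientations): `blochSemiregularSpreadSmoothComponents_of_subscheme`. Inputs, all proved in the
tree: `subschemeClass_eq_sum_complexGysin_one` (`[Z] = Σⱼ ιⱼ_* 1` for a reduced `Z` with smooth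
components, `BlochSemiregularSpreadOfSubschemeComponents.lean`), `subschemeCycle_mem_cyclesOfDim`
(`[Z] ∈ Z_m(X₀)`), `nonempty_resolutionFamily` (Hironaka), and the dimension bookkeeping
`dim + codim = n` on the smooth projective `X₀` (`exists_height_eq_coheight_eq`) giving the codimension
clause `p ≤ codim z` on `|Z| = ⋃ⱼ ιⱼ(Kⱼ)` (each `ιⱼ(Kⱼ) = closure {xⱼ}`, `dim xⱼ = m`, `m + p = n`, and
`codim` is antitone). Net effect for the trust base: consumers of `BlochSemiregularSpreadSmoothComponents`
may instead assume `BlochSemiregularSpreadOfSubscheme` and `Fulton1998_degreeFormula_complexOrientation`.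

## References

* [Bloch1972Semiregularity] S. Bloch, Semi-regularity and de Rham cohomology, Invent. Math. 17 (1972)
  51–66: §0, Thm. (7.1), Thm. (7.4), Remark (7.5).
* [BuchweitzFlenner2003] R.-O. Buchweitz, H. Flenner, Compositio Math. 137 (2003): Thm. 5.2; proof of
  Cor. 4.12 (`[Z] = ch_p(𝒪_Z)`).
* [Fulton1998] W. Fulton, Intersection Theory: §1.5 (`[Z] = Σ mᵢ[Zᵢ]`), Lemma 19.1.2, §19.1.
* [VoisinHodgeI2002] C. Voisin, Hodge Theory and Complex Algebraic Geometry I, §11.1.4 (`[Z] = τ_* 1`).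
-/

noncomputable section

open CategoryTheory CategoryTheory.Limits AlgebraicGeometry Opposite TopologicalSpace Order

namespace Literature.AlgebraicGeometry.HodgeTheory

open Literature.AlgebraicGeometry.Motives Literature.AlgebraicTopology.SingularHomology

section OfSubscheme

/-- **The smooth-components form of Bloch's theorem is a corollary of the subscheme form**, granted
Fulton's degree formula for the complex orientations: `BlochSemiregularSpreadOfSubscheme n p` (Bloch
(7.4) / BF Thm. 5.2 for an arbitrary local complete intersection subscheme, class `[Z]`) implies
`BlochSemiregularSpreadSmoothComponents n p` (the same for `Z` reduced with smooth components, class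
`Σⱼ ιⱼ_* 1`). Proof: `Z ↪ X₀` is locally Noetherian (closed in the smooth projective `X₀`); choose a
resolution family `ρ` in dimension `m` (Hironaka); `[Z] ∈ Z_m(X₀)` and `[Z] = Σⱼ ιⱼ_* 1`
(`subschemeCycle_mem_cyclesOfDim`, `subschemeClass_eq_sum_complexGysin_one` — here the degree formula
enters); every point of `|Z| = ⋃ⱼ closure {xⱼ}` has codimension `≥ codim xⱼ = n - m = p`; apply the
subscheme fact with `x := Σⱼ ιⱼ_* 1`. [cite: Bloch1972Semiregularity, Thm. (7.4) with §0 and Thm. (7.1)]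
[cite: Fulton1998, §1.5 and Lemma 19.1.2] [cite: VoisinHodgeI2002, §11.1.4] -/
theorem blochSemiregularSpreadSmoothComponents_of_subscheme {n p : ℕ}
    (hB : Fulton1998_degreeFormula_complexOrientation) (h : BlochSemiregularSpreadOfSubscheme n p) :
    BlochSemiregularSpreadSmoothComponents n p := by
  intro m hmn X₀ hX₀ r K hK ι Z i 𝒳 S f s₀ e W hι hinj hreg hred hcover hsr hf h𝒳 hS hSm hW hx
  haveI : IsLocallyNoetherian X₀.left := Motives.IsSmoothProjective.isLocallyNoetherian_holds hX₀
  have hi : IsClosedImmersion i := hreg.isClosedImmersion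
  haveI := hi
  haveI : IsLocallyNoetherian Z := LocallyOfFiniteType.isLocallyNoetherian i
  haveI := hred
  haveI := fun j ↦ irreducibleSpace_of_isSmoothProjective' (hK j)
  obtain ⟨ρ⟩ := nonempty_resolutionFamily hX₀ m
  have hinj' : Function.Injective fun j ↦ Set.range (ι j).left.base := fun j j' hjj' ↦ hinj j j' hjj'
  -- every point of `|Z|` has codimension `≥ p` in `X₀`
  have hcodim : ∀ z ∈ Set.range i.base, (p : ℕ∞) ≤ Order.coheight z := by
    intro z hz
    rw [hcover] at hz
    obtain ⟨j, hzj⟩ := Set.mem_iUnion.1 hz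
    haveI := hι j
    set x : X₀.left := (ι j).left.base (genericPoint (K j).left) with hxdef
    have hclos : closure ({x} : Set X₀.left) = Set.range (ι j).left.base := by
      have h' := (genericPoint_spec (K j).left).image (ι j).left.continuous
      rw [Set.image_univ, (ι j).left.isClosedEmbedding.isClosed_range.closure_eq] at h'
      exact h'
    have hxm : height x = (m : ℕ∞) := by
      rw [hxdef, height_base_eq_of_isClosedImmersion' (ι j).left,
        height_eq_of_isGenericPoint (hK j) (genericPoint_spec (K j).left)]
    obtain ⟨a, c, ha, hc, hac⟩ := exists_height_eq_coheight_eq hX₀ x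
    have ham : a = m := by
      have h' : ((a : ℕ) : ℕ∞) = m := by rw [← ha, hxm]
      exact_mod_cast h'
    have hcp : c = p := by omega
    have hzx : z ≤ x := by
      rw [← hclos] at hzj
      exact Scheme.le_iff_specializes.2 (specializes_iff_mem_closure.2 hzj)
    calc (p : ℕ∞) = Order.coheight x := by rw [hc, hcp]
      _ ≤ Order.coheight z := coheight_anti hzx
  have hmem := subschemeCycle_mem_cyclesOfDim i hi hK ι hι hinj' hcover
  have hcls := subschemeClass_eq_sum_complexGysin_one hB hX₀ hmn ρ i hi hK ι hι hinj' hcover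
  exact h X₀ Z i _ 𝒳 S f s₀ e W hX₀ m hmn ρ hi hreg hcodim hsr hmem hcls.symm hf h𝒳 hS hSm hW hx

end OfSubscheme

end Literature.AlgebraicGeometry.HodgeTheory

end
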